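import Literature.NumberTheory.EllipticCurves.ZpExtensionEisensteinTwistResidualTorsionProofs
import Literature.NumberTheory.EllipticCurves.ModPSchurOrdinaryBaseChangeProofs
import HarnessLib

/-!
# Howard's hypothesis H.1 for the specialised modules `T_𝔮/p^k T_𝔮 = E[p^k] ⊗ A_{m,k}(ψ)`, BY NAME in the tree's
# typing `Howard2004.H1` (proofs file)

Topic `NumberTheory/EllipticCurves`. THEOREMS ONLY; no definition, no named fact, no instance, no `sorry`.

Howard, Compositio 140 (2004), §1.3 H.1: «`T̄` is an absolutely irreducible representation of `(R/𝔪)[[G_K]]`»; proof of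
Prop. 2.1.3 (arXiv 3.1.3) for `T_𝔭 = T_pE ⊗ S_𝔭`: «observe that `T̄_𝔭 ≅ E[p] ⊗ S_𝔭/𝔪` … trivial on the second factor …
[so the hypothesis on `E[p]`] implies that `G_K → Aut_{S_𝔭}(T̄_𝔭)` is also [as required]». The tree's typing
(`Literature.NumberTheory.GaloisCohomology.Howard2004.H1 ρ ρbar πbar`, file `Howard2004/SelmerTriples.lean`) is the
conjunction: `IsQuotientBy ρ 𝔪 ρbar πbar` ∧ (no proper non-zero `Γ_K`-stable `R`-submodule of `T̄`) ∧ `Nontrivial T̄` ∧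
(Schur: every `Γ_K`-equivariant `R`-linear endomorphism of `T̄` is a scalar `c ∈ R`).

For `R = A_{m,k}` (`m, k ≥ 1`), `T = E[p^k] ⊗ A_{m,k}(ψ)` (`ZpExtension.eisensteinTwist κ (E[p^k]) hm k`, ANY `κ`) and
`T̄ = E[p]` with the `A_{m,k}`-structure through the residue character (`EisensteinCoeff.residueModule`):
* clause 1 is `WeierstrassCurve.exists_isQuotientBy_eisensteinTwist_geomTorsion` (sibling file);
* clause 2 ⟸ `(irr_K)` = `W.HasIrreducibleModPGaloisRep p` (an `A_{m,k}`-submodule of `E[p]` is a subgroup);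
* clause 3 ⟸ `E[p] ≅ (ℤ/p)²` (`nonempty_geomTorsion_addEquiv_fin_two`, `p ∤ char K`);
* clause 4 ⟸ the SCHUR FORM «every `Γ_K`-equivariant additive endomorphism of `E[p]` is an integer scalar» (tree:
  `CastellaGrossiLeeSkinner2022.Thm413Hypotheses.exists_forall_eq_zsmul_of_hasIrreducibleModPGaloisRep`, p630891), the
  integer `c` acting on `E[p]` as the class `(c : A_{m,k})` does.

* `WeierstrassCurve.howardH1_eisensteinTwist_geomTorsion_of_schur` — generic: `(irr_K)` + Schur form ⇒ `H1`;
* **`CastellaGrossiLeeSkinner2022.Thm413Hypotheses.howardH1_eisensteinTwist_geomTorsion`** — under the standing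
  hypotheses of the rows-9/10 letter (`Thm413Hypotheses N W K p κ₀ γ` + `(irr_K)`): `Howard2004.H1` for `T_𝔮/p^k` over
  `K`, for every `ℤ_p`-extension datum `κ` (in particular `κ₀.unitTwist (−1)`), every `m, k ≥ 1` — v9-plan STUB 1a,
  field `h1`, BY NAME.
HONEST FRAMING: H.1 is one of six hypotheses of a cited theorem; nothing about Selmer groups is asserted; BSD is not proved.

Cell `pub/bsd-print-x9`, seat `bsd-line-x9-p1-w2` (g5), crux stmt-BirchSwinnertonDyer-27077.

References: [Howard2004HeegnerKolyvagin] §1.3 H.1, proof of Prop. 2.1.3; [Serre1972] §1.11 Prop. 11 (via p630891);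
[SilvermanAEC2009] Cor. III.6.4(b).
-/

noncomputable section

open scoped TensorProduct

namespace WeierstrassCurve

open Literature.NumberTheory.EllipticCurves Literature.NumberTheory.GaloisRepresentations Field
open Literature.NumberTheory.EllipticCurves.IwasawaAlgebra

variable {K : Type} [Field K] (W : WeierstrassCurve K) {p : ℕ} [hp : Fact p.Prime]

/-- On a `p`-torsion group, an integer `c` acts as `(c mod p).val`. [cite: SilvermanAEC2009, III.§6 (E[m])] -/
theorem zsmul_geomTorsion_eq_val_nsmul (c : ℤ) (P : geomTorsion W (p : ℤ)) :
    c • P = (c : ZMod p).val • P := by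
  have hpP : (p : ℤ) • P = 0 := by
    apply Subtype.ext
    rw [AddSubgroupClass.coe_zsmul, (mem_geomTorsion_iff W (p : ℤ) (P : geomPoints W)).mp P.2]
    rfl
  rw [← natCast_zsmul, ZMod.val_intCast]
  conv_lhs => rw [← Int.emod_add_mul_ediv c p, add_zsmul, mul_comm, mul_zsmul, hpP, zsmul_zero, add_zero]

/-- **H.1 for `T_𝔮/p^k = E[p^k] ⊗ A_{m,k}(ψ)` from `(irr_K)` and the Schur form on `E[p]`** (generic version: `W/K`
elliptic, `p ∤ char K`, any `κ`, `m, k ≥ 1`): with `T̄ = E[p]` an `A_{m,k}`-module through the residue character, there is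
a presentation `π : E[p^k] ⊗ A_{m,k} ↠ E[p]` (`π (1 ⊗ P) = p^{k−1} P`) with `Howard2004.H1 (eisensteinTwist κ E[p^k]) (E[p]) π`.
[cite: Howard2004HeegnerKolyvagin, §1.3 H.1 and proof of Prop. 2.1.3] [cite: SilvermanAEC2009, Cor. III.6.4(b)] -/
theorem howardH1_eisensteinTwist_geomTorsion_of_schur [W.IsElliptic] (hpK : (p : K) ≠ 0)
    (hirr : W.HasIrreducibleModPGaloisRep p)
    (hschur : ∀ φ : geomTorsion W (p : ℤ) →+ geomTorsion W (p : ℤ),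
      (∀ (g : absoluteGaloisGroup K) (P : geomTorsion W (p : ℤ)), φ (g • P) = g • φ P) →
        ∃ c : ℤ, ∀ P : geomTorsion W (p : ℤ), φ P = c • P)
    (κ : ZpExtension K p) {m : ℕ} (hm : 1 ≤ m) {k : ℕ} (hk : 1 ≤ k) :
    letI := EisensteinCoeff.isLocalRing_eisensteinCoeff p hm hk
    letI := EisensteinCoeff.residueModule (p := p) (m := m) (k := k) hm hk
      (W.prime_nsmul_geomTorsion_eq_zero (p := p))
    ∃ π : EisensteinCoeff.Twisted p m k (geomTorsion W ((p : ℤ) ^ k)) →ₗ[EisensteinCoeff p m k]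
        geomTorsion W (p : ℤ),
      (∀ P : geomTorsion W ((p : ℤ) ^ k),
        ((π (EisensteinCoeff.Twisted.tmul 1 P) : geomTorsion W (p : ℤ)) : geomPoints W) =
          ((p : ℤ) ^ (k - 1)) • (P : geomPoints W)) ∧
      Literature.NumberTheory.GaloisCohomology.Howard2004.H1
        (κ.eisensteinTwist (W.torsionGaloisModule ((p : ℤ) ^ k)) hm k) (W.torsionGaloisModule (p : ℤ)) π := by
  haveI : Fact (1 < p) := ⟨hp.out.one_lt⟩
  letI := EisensteinCoeff.isLocalRing_eisensteinCoeff p hm hk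
  letI := EisensteinCoeff.residueModule (p := p) (m := m) (k := k) hm hk
    (W.prime_nsmul_geomTorsion_eq_zero (p := p))
  obtain ⟨π, hπ, hq⟩ := W.exists_isQuotientBy_eisensteinTwist_geomTorsion (p := p) κ hm hk
  refine ⟨π, hπ, hq, ?_, ?_, ?_⟩
  · -- no proper non-zero `Γ_K`-stable `A_{m,k}`-submodule: such a submodule is a `Γ_K`-stable subgroup of `E[p]`
    intro V hV
    rcases hirr V.toAddSubgroup (fun σ P hP ↦ by
      have h := hV σ P hP
      rwa [torsionGaloisModule_apply_apply] at h) with h | h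
    · left
      rw [eq_bot_iff]
      intro x hx
      have hx' : x ∈ V.toAddSubgroup := hx
      rw [h] at hx'
      exact hx'
    · right
      rw [eq_top_iff]
      intro x _
      have hx' : x ∈ V.toAddSubgroup := by rw [h]; trivial
      exact hx'
  · -- `E[p] ≅ (ℤ/p)²` is non-trivial
    obtain ⟨e⟩ := W.nonempty_geomTorsion_addEquiv_fin_two (m := p) hpK
    exact e.toEquiv.nontrivial
  · -- Schur: an equivariant `A_{m,k}`-linear endomorphism is an integer scalar `c`, acting as `(c : A_{m,k})`
    intro f hf
    obtain ⟨c, hc⟩ := hschur f.toAddMonoidHom fun g P ↦ by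
      have h := hf g P
      rw [torsionGaloisModule_apply_apply, torsionGaloisModule_apply_apply] at h
      exact h
    refine ⟨(c : EisensteinCoeff p m k), fun P ↦ ?_⟩
    rw [LinearMap.toAddMonoidHom_coe] at hc
    rw [hc, EisensteinCoeff.residueModule_smul p hm hk, map_intCast, zsmul_geomTorsion_eq_val_nsmul]

/-- **H.1 for the specialised modules on the frames of the rows-9/10 letter, BY NAME.** Under the standing hypotheses
of CGLS 2022 Thm. 4.1.3 (`Thm413Hypotheses N W K p κ₀ γ`: `p` odd, good ordinary, `K` imaginary quadratic with
`p ∤ d_K`, …) together with `(irr_K)`, for every `ℤ_p`-extension datum `κ` and all `m, k ≥ 1`: Howard's H.1 —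
`Howard2004.H1 (κ.eisensteinTwist (E_K[p^k]) hm k) (E_K[p]) π` — holds for a presentation `π : E_K[p^k] ⊗ A_{m,k} ↠ E_K[p]`
with `π (1 ⊗ P) = p^{k−1} P`, the Schur clause being the tree's `exists_forall_eq_zsmul_of_hasIrreducibleModPGaloisRep`
(Serre's inertia device at a good ordinary `p`). [cite: Howard2004HeegnerKolyvagin, §1.3 H.1 and proof of Prop. 2.1.3]
[cite: Serre1972, §1.11 Prop. 11 and Cor.] -/
theorem _root_.Literature.NumberTheory.EllipticCurves.CastellaGrossiLeeSkinner2022.Thm413Hypotheses.howardH1_eisensteinTwist_geomTorsion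
    {N : ℕ} {W : WeierstrassCurve ℚ} [W.IsGloballyMinimal] {K : Type} [Field K] [NumberField K]
    {p : ℕ} [Fact p.Prime] {κ₀ : ZpExtension K p} {γ : absoluteGaloisGroup K}
    (hyp : CastellaGrossiLeeSkinner2022.Thm413Hypotheses N W K p κ₀ γ)
    (hirr : (W.baseChange K).HasIrreducibleModPGaloisRep p)
    (κ : ZpExtension K p) {m : ℕ} (hm : 1 ≤ m) {k : ℕ} (hk : 1 ≤ k) :
    letI := EisensteinCoeff.isLocalRing_eisensteinCoeff p hm hk
    letI := EisensteinCoeff.residueModule (p := p) (m := m) (k := k) hm hk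
      ((W.baseChange K).prime_nsmul_geomTorsion_eq_zero (p := p))
    ∃ π : EisensteinCoeff.Twisted p m k (geomTorsion (W.baseChange K) ((p : ℤ) ^ k)) →ₗ[EisensteinCoeff p m k]
        geomTorsion (W.baseChange K) (p : ℤ),
      (∀ P : geomTorsion (W.baseChange K) ((p : ℤ) ^ k),
        ((π (EisensteinCoeff.Twisted.tmul 1 P) : geomTorsion (W.baseChange K) (p : ℤ)) :
            geomPoints (W.baseChange K)) = ((p : ℤ) ^ (k - 1)) • (P : geomPoints (W.baseChange K))) ∧
      Literature.NumberTheory.GaloisCohomology.Howard2004.H1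
        (κ.eisensteinTwist ((W.baseChange K).torsionGaloisModule ((p : ℤ) ^ k)) hm k)
        ((W.baseChange K).torsionGaloisModule (p : ℤ)) π := by
  haveI : W.IsElliptic := hyp.isElliptic
  have hpK : (p : K) ≠ 0 := by exact_mod_cast (Fact.out : p.Prime).ne_zero
  exact (W.baseChange K).howardH1_eisensteinTwist_geomTorsion_of_schur hpK hirr
    (fun φ hφ ↦ hyp.exists_forall_eq_zsmul_of_hasIrreducibleModPGaloisRep hirr φ hφ) κ hm hk

end WeierstrassCurve

end
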